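import Literature.AnabelianGeometry.SemiGraphs.StableReductionTowerNonVacuity
import Literature.AnabelianGeometry.SemiGraphs.ArithSemiGraphNonVacuity
import HarnessLib

/-!
# [SemiAnbd] Ex. 5.6: the tower record `StableReductionTower` is inhabited AT THE REAL VOCABULARY
# `SemiAnbdVocab.ofReal` (degenerately) — composition of the two producers

Mochizuki, *Semi-graphs of anabelioids*, Publ. RIMS **42** (2006), §5 Example 5.6, manuscript p. 67
[cite: MochizukiSemiAnbd2006, Ex 5.6, p. 67].  PROOF-ONLY sequel (abc-iut cell, NV lane, seat
abc-iut-w6-d117; no `def`, no `instance`, no named fact) composing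

* abc-iut-L3-t7's `StableReductionTower.exists_of_arithSemiGraph` (`StableReductionTowerNonVacuity.lean`):
  over an algebraically closed field, ANY connected arithmetic semi-graph of anabelioids with trivial
  `π̂₁(A)` is the constant level of some (degenerate) Example 5.6 tower record, with
* `ArithSemiGraph.exists_ofReal` (`ArithSemiGraphNonVacuity.lean`): such an arithmetic semi-graph of
  anabelioids EXISTS over the real vocabulary `SemiAnbdVocab.ofReal R` (Example 2.10 model on the
  one-vertex edgeless semi-graph, trivial arithmetic action).

Hence `StableReductionTower.exists_ofReal`: for every bridge residual `R` and every algebraically closed `K`,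
`∃ D : TemperedArithmeticGroup K, Nonempty (StableReductionTower (SemiAnbdVocab.ofReal R) D)` — the record of
Example 5.6 is inhabited over the vocabulary in which the layer's statements are read, unconditionally.
DEGENERATE (trivial `Π`, `G_K`, `π̂₁(A_i)`; constant tower) and labelled so; nothing here is the
stable-reduction tower of a curve; nothing here asserts a statement of [SemiAnbd] or bears on
[IUTchIII] Cor. 3.12.
-/

noncomputable section

namespace Literature.AnabelianGeometry.SemiGraphs

open _root_.CategoryTheory SgAQuot SgAQuot.SgA

universe u'

/-- **`StableReductionTower` is inhabited at the real vocabulary**: over any algebraically closed field `K`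
(so `G_K = 1`) and for every bridge residual `R`, some `D : TemperedArithmeticGroup K` (the degenerate one,
`Π = 1`) carries an Example 5.6 tower record over `SemiAnbdVocab.ofReal R`, whose constant level is the
one-vertex Example 2.10 semi-graph of anabelioids with trivial arithmetic component.
[cite: MochizukiSemiAnbd2006, Ex 5.6, p. 67] -/
theorem StableReductionTower.exists_ofReal (R : SgA.BridgeResidual.{0, 1, 0}) (K : Type u') [Field K]
    [IsAlgClosed K] :
    ∃ D : TemperedArithmeticGroup K, Nonempty (StableReductionTower (SemiAnbdVocab.ofReal R) D) := by
  obtain ⟨𝔊, hPA, -⟩ := ArithSemiGraph.exists_ofReal R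
  haveI := hPA
  exact StableReductionTower.exists_of_arithSemiGraph K 𝔊

/-- The same with the level exposed: the tower can be chosen CONSTANT with level a prescribed real-vocabulary
arithmetic semi-graph of anabelioids `𝔊` with `π̂₁(A) = 1` — in particular one whose geometric component has
one vertex and no edges. [cite: MochizukiSemiAnbd2006, Ex 5.6, p. 67] -/
theorem StableReductionTower.exists_ofReal_oneVertex (R : SgA.BridgeResidual.{0, 1, 0}) (K : Type u')
    [Field K] [IsAlgClosed K] :
    ∃ (𝔊 : ArithSemiGraph (SemiAnbdVocab.ofReal R)) (D : TemperedArithmeticGroup K),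
      Subsingleton 𝔊.PA ∧ Nonempty (Unique ((SemiAnbdVocab.ofReal R).Vert 𝔊.G)) ∧
        IsEmpty ((SemiAnbdVocab.ofReal R).Edge 𝔊.G) ∧
          Nonempty (StableReductionTower (SemiAnbdVocab.ofReal R) D) := by
  obtain ⟨𝔊, hPA, -, hV, hE⟩ := ArithSemiGraph.exists_ofReal R
  haveI := hPA
  obtain ⟨D, hD⟩ := StableReductionTower.exists_of_arithSemiGraph K 𝔊
  exact ⟨𝔊, D, hPA, hV, hE, hD⟩

end Literature.AnabelianGeometry.SemiGraphs

end
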